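import Literature.MathematicalPhysics.QuantumFieldTheory.Balaban1983to89.Node00.Record13CarriersXPinnedHSCoPH
import Literature.MathematicalPhysics.QuantumFieldTheory.Balaban1983to89.Node00.Record13CarriersB8SubBHCoPH

/-!
v1.7 `CoPH` IMAGE (token map T₇ of dag-lead WORDS-143 ∕ node00-def-T `KEYMAP-Record13-v1.7.md`: binder `θ : Stage13HParams` (= `Stage13RParams` + the HISTORY-INDEXED residual 𝐓-weight slot `Zh`, director-ym №183 FINDING №9), `CoPR ↦ CoPH`, dotted `Stage13RParams.X ↦ Stage13HParams.X`, SITE-RULE `X F N θ ↦ X F N θ.toStage13Params` for the edition-free θ-level objects) of this seat's v1.6 file of the same stem (which STANDS as a settled helper, as does the v1.5 one); H-level pins over dag-n10-d's `Stage13HParams.rebindX` (`Node00/Record13CarriersCoPH` §0, p539476).  Prose pids ∕ FILE numbers below are those of the v1.5 ∕ v1.6 lineage where not updated; this image's v1.7 suppliers are node00-def-T FILE 27 p537939 `Record13CoPH` ∕ FILE 28T p539169 `Record13SepCoPH`, dag-n10-d g11 p539476 `Record13CarriersCoPH` ∕ p540513 `Record13CarriersSepCoPH` ∕ p542283 `Record13SClassSepCoPH`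 (the generic S-class `IsRecordOfRecord₁₃CSepCoPHS`, of which this seat's S-bound records are one-pin ∕ X-H-pin ∕ four-pin-view SLICES — membership lemmas `isRecordOfRecord₁₃CSepCoPHS_of_…` below).

# NODE 00 (YM-PLAN Track A) — [III]'s END STATEMENT (B) FROM THE NODES AT THE S-BOUND v1.7 RECORDS: `endStatementBPrinted_of_isRecordOfRecord₁₃CSepCoPHSX3H_of_nodes` and
# `endStatementBPrinted_of_isRecordOfRecord₁₃CSepCoPHSB8subBH_of_nodes` — def-T's `endStatementBPrinted_of_isRecordOfRecord₁₃CSepCoPH_of_nodes` (FILE 24T) RE-RUN at the two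
# S-bound records of this seat (at ⁷: `Record13CarriersXPinnedHSCoPH` p546521, `Record13CarriersB8SubBHCoPH` p544247; v1.5 lineage p526966 ∕ p523976), through their membership in dag-n10-d's generic S-class `IsRecordOfRecord₁₃CSepCoPHS` (`Record13SClassSepCoPH` p542283: `rgFlow_of_smallCouplings_of_isRecordOfRecord₁₃CSepCoPHS`,
# `endStatementBPrinted_of_isRecordOfRecord₁₃CSepCoPHS_of_nodes` BY NAME; at v1.5 ∕ v1.6 the same was re-derived through the C-bound companions)

NODE 00 RECORD MODULE (seat `pub-ymgap-dag-n05-d` g7, 2026-08-27; APPEND-ONLY new module, everything BY NAME).  WHY (this seat's LOCATED-K1V3-B8, 11:31Z): the K1⁵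
skeleton's rung binds its world by the C-bound record `IsRecordOfRecord₁₃CSepCoPH`, at which N05's leaf is the TYPED Theorem-8 form no knit serves; the S-bound records carry
N05's SURVIVING leaf (served by `BalabanUVNodesN05SubBHKnitUnivT8Srv` modulo its displayed hypotheses).  For the rung to be statable over an S-bound record, the composition
`nodes at the record's world ⇒ (B) printed at the datum` must exist there exactly as def-T proves it at the C-bound record.  It does, by the same three steps: (B) is a WORLD-level
consequence (`Record5.endStatementBPrinted_of_nodesP_interval_guarded`: nodes at every run + the (0.20) guard `smallCouplings → rgFlow` + the β bounds along runs in the window), the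
guard is a LEAF other than `b8`, hence equal to the C-bound companion's (`companion_of_…`: `leavesP w P = { leavesP w′ P with b8 := … }`), where def-T's
`rgFlow_of_smallCouplings_of_isRecordOfRecord₁₃CSepCoPH` supplies it, and `w.C = D.C` is a clause of the record.
AT v1.7 the three steps are dag-n10-d's, ONCE, at the generic S-class (`endStatementBPrinted_of_isRecordOfRecord₁₃CSepCoPHS_of_nodes`); this file instantiates them at the two SLICES through the membership lemmas `isRecordOfRecord₁₃CSepCoPHS_of_isRecordOfRecord₁₃CSepCoPHSX3H ∕ …SB8subBH` (one term each).
WHAT IS PROVED: `rgFlow_of_smallCouplings_of_isRecordOfRecord₁₃CSepCoPHSX3H`, ★ `endStatementBPrinted_of_isRecordOfRecord₁₃CSepCoPHSX3H_of_nodes`; `rgFlow_of_smallCouplings_of_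
isRecordOfRecord₁₃CSepCoPHSB8subBH`, ★ `endStatementBPrinted_of_isRecordOfRecord₁₃CSepCoPHSB8subBH_of_nodes` — signatures = def-T's with the record predicate swapped.  So a v4 rung
«∃ θ h w (+ pins), … ∧ IsRecordOfRecord₁₃CSepCoPHSX3H F 2 (datumOfRecord₁₃SepCoPH θ h) w ∧ (∀ P, Nodes (leavesP w P)) ∧ …» composes to K1⁵'s consequent by THIS lemma in place of
def-T's, token for token (the plan's word, not asserted here).
HONEST FRAMING: kernel bookkeeping by name; NO estimate; nothing of Bałaban's asserted; (B) is derived only from the HYPOTHESIS «all nodes at every run» + the β bounds — no node is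
discharged; N05 NOT discharged; K1 NOT claimed; counts unmoved; one finite T⁴ programme at fixed ε — NOT continuum ∕ ℝ⁴ ∕ OS ∕ mass gap ∕ Clay.  No `sorry`, no definition.
[cite: Balaban1988Convergent, Thm 2 + (2.45)–(2.50) pp.262–263 (end statement (B)); Balaban1989LargeFieldII, Thm 1 + (0.1) pp.355–356; Balaban1987RG1, (0.20) p.256, (1.20)–(1.22) p.264 (bookkeeping)]
-/

noncomputable section

namespace Literature.MathematicalPhysics.QuantumFieldTheory.Balaban1983to89.Node00

open T4Continuum AveragingRT T4FiniteEpsInhabited FlowStep FlowStepRuns DagBinding T4DatumAssembly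
open scoped Matrix.Norms.L2Operator

variable {F : T4Family} {N : ℕ} [NeZero N] {D : FiniteEpsData F (SU N)} {w : WorldP}

/-- GUARDED (0.20) at every run of an S-bound X-pinned v1.7 record: dag-n10-d's `rgFlow_of_smallCouplings_of_isRecordOfRecord₁₃CSepCoPHS` at the
REPAIRED-X-PIN SLICE of the generic S-class (membership `isRecordOfRecord₁₃CSepCoPHS_of_isRecordOfRecord₁₃CSepCoPHSX3H`; the leaf reads `w.C`, `w.γ` only). [cite: Balaban1987RG1, (0.20) p.256 (bookkeeping)] -/
theorem rgFlow_of_smallCouplings_of_isRecordOfRecord₁₃CSepCoPHSX3H (h : IsRecordOfRecord₁₃CSepCoPHSX3H F N D w) (P : B12.RunParams)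
    (hsc : (leavesP w P).smallCouplings) : (leavesP w P).rgFlow :=
  rgFlow_of_smallCouplings_of_isRecordOfRecord₁₃CSepCoPHS (isRecordOfRecord₁₃CSepCoPHS_of_isRecordOfRecord₁₃CSepCoPHSX3H h) P hsc

/-- ★ **[III]'s END STATEMENT (B) AT THE DATUM OF AN S-BOUND X-PINNED v1.7 RECORD FROM THE NODES AT ITS WORLD** (dag-n10-d's `endStatementBPrinted_of_isRecordOfRecord₁₃CSepCoPHS_of_nodes`
at the slice = def-T's `endStatementBPrinted_of_isRecordOfRecord₁₃CSepCoPH_of_nodes` with the record predicate swapped; same hypotheses: nodes at every run, the window bound `w.γ ≤ γ₀`, the β bounds in the interval).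
[cite: Balaban1988Convergent, Thm 2 + (2.45)–(2.50) pp.262–263; Balaban1989LargeFieldII, Thm 1 p.355 (bookkeeping)] -/
theorem endStatementBPrinted_of_isRecordOfRecord₁₃CSepCoPHSX3H_of_nodes (h : IsRecordOfRecord₁₃CSepCoPHSX3H F N D w) {γ₀ : ℝ} (hγ₀ : w.γ ≤ γ₀)
    (hnodes : ∀ P, Nodes (leavesP w P)) (hβ : BetaBoundsInInterval w.C.toB12 γ₀ w.b w.βup) :
    B16.EndStatementBPrinted D.C :=
  endStatementBPrinted_of_isRecordOfRecord₁₃CSepCoPHS_of_nodes (isRecordOfRecord₁₃CSepCoPHS_of_isRecordOfRecord₁₃CSepCoPHSX3H h) hγ₀ hnodes hβ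

/-- GUARDED (0.20) at every run of a one-pin S-bound [B8″H] v1.7 record (the ONE-PIN SLICE; membership `isRecordOfRecord₁₃CSepCoPHS_of_isRecordOfRecord₁₃CSepCoPHSB8subBH`).
[cite: Balaban1987RG1, (0.20) p.256 (bookkeeping)] -/
theorem rgFlow_of_smallCouplings_of_isRecordOfRecord₁₃CSepCoPHSB8subBH (h : IsRecordOfRecord₁₃CSepCoPHSB8subBH F N D w) (P : B12.RunParams)
    (hsc : (leavesP w P).smallCouplings) : (leavesP w P).rgFlow :=
  rgFlow_of_smallCouplings_of_isRecordOfRecord₁₃CSepCoPHS (isRecordOfRecord₁₃CSepCoPHS_of_isRecordOfRecord₁₃CSepCoPHSB8subBH h) P hsc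

/-- ★ **[III]'s END STATEMENT (B) AT THE DATUM OF A ONE-PIN S-BOUND [B8″H] v1.7 RECORD FROM THE NODES AT ITS WORLD** (dag-n10-d's S-class lemma at the slice).
[cite: Balaban1988Convergent, Thm 2 + (2.45)–(2.50) pp.262–263; Balaban1989LargeFieldII, Thm 1 p.355 (bookkeeping)] -/
theorem endStatementBPrinted_of_isRecordOfRecord₁₃CSepCoPHSB8subBH_of_nodes (h : IsRecordOfRecord₁₃CSepCoPHSB8subBH F N D w) {γ₀ : ℝ} (hγ₀ : w.γ ≤ γ₀)
    (hnodes : ∀ P, Nodes (leavesP w P)) (hβ : BetaBoundsInInterval w.C.toB12 γ₀ w.b w.βup) :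
    B16.EndStatementBPrinted D.C :=
  endStatementBPrinted_of_isRecordOfRecord₁₃CSepCoPHS_of_nodes (isRecordOfRecord₁₃CSepCoPHS_of_isRecordOfRecord₁₃CSepCoPHSB8subBH h) hγ₀ hnodes hβ

#print axioms endStatementBPrinted_of_isRecordOfRecord₁₃CSepCoPHSX3H_of_nodes
#print axioms endStatementBPrinted_of_isRecordOfRecord₁₃CSepCoPHSB8subBH_of_nodes

end Literature.MathematicalPhysics.QuantumFieldTheory.Balaban1983to89.Node00

end
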